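import Summits.Ventures.AbcSig.Recipes.BS04

/-!
# Venture AbcSig — level 18: NO newforms (hand-written, trivial level file)

HONEST FRAMING. `S₂^new(Γ₀(18))` is zero (indeed `S₂(Γ₀(18)) = 0`; [BS04, Prop. 4.1] lists 18 among the levels with no
weight-2 cusp forms). In the cell's Lean layer this is the COMPUTED/CITED hypothesis `DataComplete 18 level18Orbits` with the
EMPTY orbit list — nothing is certified by the kernel here except that an empty list needs no certificate. No claim on
ABC or any summit.
-/

namespace Summit.Ventures.AbcSig

/-- The (empty) list of newform orbits of level 18. -/
def level18Orbits : List OrbitData := []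

/-- Level 18 summary: vacuous (no orbits). Same shape as the generated `levelN_sieve` theorems. -/
theorem level18_sieve (n : ℕ) (_hn : n.Prime) (_hmin : 7 ≤ n) (X : OrbitData → Prop) :
    ∀ o ∈ level18Orbits, (∀ e ∈ o.coeffs, e.ell.Prime ∧ e.ell ≠ 2 ∧ ¬ e.ell ∣ 18) ∧ (o.Eliminated bs04Allowed n ∨ X o) := by
  intro o ho
  simp [level18Orbits] at ho

end Summit.Ventures.AbcSig
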